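import Summits.HodgeConjecture.HodgeConjecture.Theses.PadicSemiregularLift
import Literature.AlgebraicGeometry.HodgeTheory.WeilClasses
import Literature.AlgebraicGeometry.Motives.WeilTypeCM
import Literature.AlgebraicGeometry.Motives.FamiliesVHS
import HarnessLib.Audit

/-!
# Line `subtorus-gallery-bloch-seeds` — skeleton for crux `PadicSemiregularLift.HodgeAbelianVarieties`
(item stmt-HodgeConjecture-1333, route route-HodgeConjecture-PadicSemiregularLift; crux-plan, planner
`planner-cruxplan-stmt-HodgeConjecture-1333-subtorus-gallery-blo-0`, 2026-08-16)

Crux (FIXED, the route's typing; rank 4 OUTPUT item):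
`HodgeAbelianVarieties := ∀ A : AbelianVariety ℂ, HodgeConjectureFor A.dim A.X` — the Hodge
conjecture for every complex abelian variety (`Disproof.lean` §1: literally the summit restricted to
abelian varieties; any kill is a disproof of HC).

Idea (crux idea card `Cruxes/HodgeAbelianVarieties/Ideas/subtorus-gallery-bloch-seeds.md`, ideator 2;
triage r1-1/2/3: pass ×3): GALLERIES OF SUBTORI AS BLOCH-SEMIREGULAR lci SEEDS AT SPLIT CM ANCHORS.
On the split CM anchor `A₀ = E_K^{2n}` (`K = ℚ(√-d)`, `K` acting with signature `(n,n)`) take a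
connected union `Z₀ = ⋃ (Bᵢ + xᵢ)` of translated `n`-dimensional abelian subvarieties, adjacent members
meeting along `(n-1)`-dimensional subtori (lci of codimension `n`), with `[Z₀] = a·θⁿ + w`, `w ≠ 0` a
Weil class; if `Z₀` is Bloch-semiregular (`H¹(Z₀, N) → H^{n+1}(A₀, Ω^{n-1})` injective — a finite
exterior-algebra rank computation, every ingredient being translation-invariant), Bloch's 1972
semiregularity theorem deforms `Z₀` sideways along the hyperbolic Weil component (where exactly
`ℚθⁿ ⊕ W_K` stay Hodge), relative Hilbert schemes + Baire + isogeny give the Weil classes on every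
hyperbolic `2n`-fold, descending gives every discriminant one dimension down, André 1992 turns Weil
classes into HC for CM abelian varieties, and the same CM-anchored engine along Mumford–Tate families
is the line's road from CM points to every abelian variety.

## Typing discipline (triage MUST-FIX honoured)

All three triagers showed that the ideator's `HasBlochWeilSeed` (an `∃` over the all-data interface
`SubschemeSemiregularityData`) is junk-inhabitable (`T2 := 0`, rigged trace), so that the first lemma
AS TYPED had the strength of its conclusion. The tree has genuine carriers for `σ₀, σ₁` of VECTOR
BUNDLES only (`AtiyahClassTraceReal.IsZeroOneSemiregular`); Bloch's map of an lci subscheme in form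
degree `n - 1 ≥ 2` has none. Hence, as the panel allowed ("re-type over an honesty predicate … or keep
the first lemma at paper level"), NO stub below mentions a semiregularity structure: the design half
of the seed problem is typed as PURE LINEAR ALGEBRA over an abstract hyperbolic Weil datum
`(K, α, V, E)` (Mathlib exterior powers + the tree's `Motives.derivationExteriorPower`), and Bloch's
theorem with the semiregularity verification lives inside the ENGINE stub, whose statement is the
junk-free sector output. Every stub is HC-implied or a theorem in print (none can be refuted without
refuting HC or the card's finite design claim), none restates the crux, none is lemma-sized.

## The five registered stubs (signatures over existing Literature / Mathlib declarations only; the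
shared statements are the `local notation3` blocks below, to be copied VERBATIM by provers)

* `stub_galleryDesigns` — `GalleryDesigns[]`, the card's finite design problem for EVERY `n ≥ 2`,
  as pure algebra over an abstract SPLIT CM ANCHOR DATUM `(K, α, V, ε, E)`: `K = ℚ(α)`, `α² = -d`;
  `V` a `K`-space of dimension `2n` — `K` acting as the CM/complex structure of `A₀ = E_K^{2n}`
  (`H₁(A₀, ℚ)`, `α` = the diagonal multiplication, `J = σ(α)/√d`); `ε` a `K`-linear involution with
  `±1`-eigenspaces of dimension `n` (the splitting `A₀ = B₊ × B₋`; the WEIL action is `α_W = α·ε`,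
  i.e. `(σ, σ̄)` on the two factors — note that the subtori of `A₀` are the `K`-(= `α_J`-)stable
  subspaces, NOT the `α_W`-stable ones: graphs of homomorphisms `B₊ → B₋` are `α_J`-linear and
  `α_W`-antilinear); `E` an alternating `ℚ`-form with `E(αx, αy) = d·E`, `E(εx, εy) = E`, Riemann
  positivity `E(x, αx) > 0` (product polarisation), and HYPERBOLIC for `α_W` (an `α_W`-stable
  `E`-Lagrangian rational subspace of dimension `2n`; van Geemen 5.2/5.4 — the card's split anchors;
  other components are reached by descending in stub 2). CLAIM: there are finitely many
  `n`-dimensional `K`-subspaces `Wᵢ` (tangent data of the members `Bᵢ`, `K`-bases `uᵢ`), positive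
  rational weights `cᵢ` (parallel disjoint copies realise multiplicities) and an adjacency graph `G`
  such that: `G` is connected; adjacent `Wᵢ ∩ Wⱼ` have dimension `n - 1`; triangles are coplanar
  (`dim (Wᵢ + Wⱼ + Wₖ) = n + 1`, lci at triple points — TRIAGE r1-3); every non-adjacent pair can be
  translated apart compatibly with the incidences (a `K`-linear condition); and the CLASS EQUATION
  holds: `x = Σ cᵢ [Wᵢ] ∈ ⋀^{2n}_ℚ V` (`[W]` = the interleaved Plücker vector `u₁ ∧ αu₁ ∧ ⋯ ∧ uₙ ∧ αuₙ`,
  the complex orientation) is annihilated by every derivation `D_φ`, `φ ∈ 𝔰𝔲(H_W) = {φ : commutes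
  with α_W, E-skew, tr_{K_W} φ = 0}` — i.e. `x ∈ ℚ·PD(θⁿ) ⊕ PD(W_K)`, the generic Hodge classes of the
  Weil family through the anchor (`Hg = SU(H_W)` generically; `(⋀^{2n})^{SU} = ⋀⁰⊗⋀^{2n} ⊕
  (⋀ⁿ⊗⋀ⁿ)^{SL} ⊕ ⋀^{2n}⊗⋀⁰`, Schur), so that Bloch's theorem deforms the seed over the WHOLE
  component — and NOT annihilated by `D_{α_W}` (eigenvalue `(a-b)σ(α)` on `⋀ᵃV_σ ⊗ ⋀ᵇV_σ̄`: non-zero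
  Weil part). Size M–L per `n` (decidable: finite search + rank computations over `K`); calibration
  `n = 3` (split sixfolds, known), prize `n = 4`; the triage's annihilator lemma (`⋂ H₁(Bᵢ) = 0`,
  ≥ 3 members, no pencils) and EKR remark are necessary conditions of it.
* `stub_galleryEngine` — `GalleryDesigns[] → CMWeil[]` (HARDEST, the line's engine; XL/open):
  Weil classes are algebraic for every CM-field action. `CMWeil[]` is typed with the tree's
  `pullbackEigenclasses A ψ (2p) χ_μ`, `χ_μ(x,y) = (x + yμ)^{2p}` (van Geemen 4.8–4.9; Deligne–Milne
  (4.3)–(4.4): `⊕_σ ⋀^{2p} H¹_σ = W_K ⊗ ℂ`), GUARDED against junk: the eigenspaces of `ψ^*` on `H¹`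
  for `μ ∈ S` exhaust `H¹` (semisimplicity), each has dimension exactly `2p` (top wedge = a line; kills
  `ψ = 𝟙`, which would be HC itself), all `μ` non-real (kills real multiplication). Road: (e = 2)
  realise a design of `stub_galleryDesigns` as a reduced lci gallery on `E_K^{2n}`, verify
  Bloch-semiregularity (the card's job GALLERY-n (β): Mayer–Vietoris for `N_{Z₀}`, per-component
  necessary condition of TRIAGE r1-1), Bloch 1972 (Invent. Math. 17) / Buchweitz–Flenner 2003 Prop. 8.2
  ⟹ the relative Hilbert scheme of the universal family over the hyperbolic PEL component is smooth
  over the base at `[Z₀]` ⟹ algebraic on a Euclidean neighbourhood ⟹ Baire + irreducibility ⟹ all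
  hyperbolic members (specialisation; tree `HodgeLocusPropagation` pattern) ⟹ isogeny descent (tree
  `WeilClassesIsogenyDescent`) ⟹ descending `8 → 6`, `2n+2 → 2n` for every discriminant (Schoen 1998
  §10, Koike, Markman survey §11.5 Step 2; tree `WeilClassesProducts`; the `d = 7`, `n = 3` instance is
  the registered stub set of crux stmt-1260's line `hyperbolic-eightfold-descent`); (general CM field
  `K`, needed by André) the split `K`-Weil components contain `E_{K'}`-power points (`K ↪ M_g(K')`),
  where Weil classes are Lefschetz and galleries of codimension-`p` subtori exist — same lever, design
  problem beyond the card (recorded, not typed); non-split types by descending (`H ⊕ (-H)` is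
  hyperbolic).
* `stub_andreCM` — `CMWeil[] → HCCM[]`: André 1992 (Markman survey arXiv:2509.23403 Thm. 1.4, READ
  p. 4: "There exist abelian varieties `Aᵢ` of split Weil type and homomorphisms `fᵢ : A → Aᵢ` such
  that every Hodge class `t` on `A` can be written as `t = Σ fᵢ^*(tᵢ)` with `tᵢ` a Weil class on `Aᵢ`")
  + pull-backs preserve algebraic classes + Hodge models of abelian varieties (GAGA + Hodge
  decomposition). `IsCM[A]` := some endomorphism has `2·dim A` distinct eigenvalues on `H¹(A(ℂ); ℂ)`
  (⟺ `End⁰(A)` contains an étale commutative subalgebra of rank `2g` ⟺ CM type). Known; size XL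
  (formalising André + the MT-torus bookkeeping), research risk nil.
* `stub_cmAnchoredFamilies` — `CMFamilies[]` (packaging; theorem in print, size L–XL): every
  `(A, c)` with `c` rational of type `(p,p)` sits in a smooth projective family `f : 𝒳 → S` over an
  irreducible quasi-projective complex base with a GLOBAL class `G ∈ H^{2p}(𝒳(ℂ); ℂ)` restricting to
  `c` on the fibre `A` (presented by a fibre inclusion `e`), restricting to a rational `(p,p)`-class on
  every abelian-variety fibre, and with a CM fibre `A₀` (moduli of polarised abelian varieties with
  level structure; the Hodge-locus component of `c` is algebraic — Cattani–Deligne–Kaplan 1995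
  Cor. 1.2, barrier file `HodgeLocusAlgebraic` used POSITIVELY — and is a special subvariety, hence
  contains CM points — Deligne, Travaux de Shimura / Mumford 1969 §3; after a finite base change the
  flat transport of `c` is a global class — theorem of the fixed part, tree `GlobalInvariantCycles`);
  plus Hodge models of abelian varieties (anti-vacuity conjunct of `HodgeConjectureFor`).
* `stub_vhcFromCMFibre` — `VHCfromCM[]` (open; XL): Grothendieck's variational Hodge statement for
  such families ANCHORED AT A CM FIBRE: if `G|_{A₀}` is algebraic on the CM fibre and `G` is a
  rational `(p,p)`-class on every abelian fibre, then `G|_B` is algebraic on every abelian fibre `B`.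
  HC-implied (cannot be refuted without refuting HC); with `HCCM[]` and `CMFamilies[]` it is the
  general-sector remainder of the crux, and it is where the line's lever acts beyond the Weil
  families: represent `G|_{A₀}` (+ divisor padding) at a well-chosen CM fibre — an `E_{K'}`-power
  point whenever the Mumford–Tate family has one — by a Bloch-semiregular gallery, apply Bloch 1972,
  spread. Its first instances ARE the hyperbolic Weil families of `stub_galleryEngine`.

`lineImplication` (sorry-free) composes the five statements into
`∀ A : AbelianVariety ℂ, HodgeConjectureFor A.dim A.X`; `HodgeAbelianVarieties_of` is the crux BY NAME
fed with the stubs (the ONLY theorem of the file whose conclusion head is the crux decl, and it has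
no hypotheses — audit (ii)).

Disproof used (`Cruxes/HodgeAbelianVarieties/Disproof.lean`, cdisprove cycle 1, NO KILL; landed
`Theorems/HodgeAbelianVarieties/Negative/ExtremeCodimensions.lean`, p70486): honoured —
`weilItems_of`/`not_of_not_weilSixfolds` (the frontier Weil sixfolds disc ≠ -1 / `2n ≥ 8` is exactly
`stub_galleryEngine`'s first new output: split `ℚ(i)`/`ℚ(√-d)` eightfolds ⟹ all sixfolds);
`hodgeAbelianVarieties_iff_deepMiddle` (only `2 ≤ p`, `2p ≤ dim` matter: `CMWeil[]` carries `0 < p`,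
the packaging is uniform in `p`); `not_integralSaturationOnAbelianVarieties` (ℚ-coefficients:
weights `cᵢ ∈ ℚ_{>0}`, `algebraicClasses` is a `ℂ`-span, no integral claim);
`not_allHodgeTypeClassesAlgebraicOnAbelianVarieties` (rationality kept in every hypothesis);
`kaehler_analogue_fails`, `_false_without_proper`, `_false_without_groupLaw` (every member of every
family is a projective abelian variety presented as `AbelianVariety ℂ`; no Kähler torus). No
`_false_without_` obstruction is contradicted; the landed Negative lemma (`ExtremeCodimensions`) has
no instance among the stubs. `ledger negatives --problem HodgeConjecture`: nothing on abelian
varieties / Weil classes. Route-internal refutations (rattack-1498-0 Godeaux–Serre, rattack-1805-0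
twist-rigidity) concern the p-adic P1/P2 and are not engaged (no fixed variety needs a supersingular
prime; anchors are CM points chosen inside families).
-/

noncomputable section

open CategoryTheory
open Literature.AlgebraicGeometry Literature.AlgebraicGeometry.Motives

namespace Summit.HodgeConjecture.HodgeConjecture.Cruxes.HodgeAbelianVarieties.SubtorusGalleryBlochSeeds

/-! ### Local notations (the shared statements; provers copy these blocks verbatim) -/

/-- `GalleryDesigns[]` — the finite design problem of the card for every `n ≥ 2`, as pure linear
algebra over an abstract split CM anchor datum `(K, α, V, ε, E)` (see the module docstring and
stub 1: `K`-scalars = the complex structure of `E_K^{2n}`, `α • ε` = the Weil action). Local notation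
only. -/
local notation3 (prettyPrint := false) "GalleryDesigns[]" =>
  ∀ (K : Type) [Field K] [Algebra ℚ K] (α : K) (d : ℕ), 0 < d →
    α * α = algebraMap ℚ K (-(d : ℚ)) →
    (∀ k : K, ∃ a b : ℚ, k = algebraMap ℚ K a + algebraMap ℚ K b * α) →
  ∀ (n : ℕ), 2 ≤ n →
  ∀ (V : Type) [AddCommGroup V] [Module ℚ V] [Module K V] [IsScalarTower ℚ K V]
    [Module.Finite K V], Module.finrank K V = 2 * n →
  ∀ (ε : V →ₗ[K] V), ε ∘ₗ ε = LinearMap.id →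
    Module.finrank K (LinearMap.ker (ε - LinearMap.id)) = n →
    Module.finrank K (LinearMap.ker (ε + LinearMap.id)) = n →
  ∀ (E : LinearMap.BilinForm ℚ V), (∀ x y : V, E x y = -E y x) →
    (∀ x y : V, E (α • x) (α • y) = (d : ℚ) * E x y) →
    (∀ x y : V, E (ε x) (ε y) = E x y) →
    (∀ x : V, x ≠ 0 → 0 < E x (α • x)) →
    (∃ L : Submodule ℚ V, (∀ x ∈ L, α • ε x ∈ L) ∧ Module.finrank ℚ L = 2 * n ∧
      ∀ x ∈ L, ∀ y ∈ L, E x y = 0) →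
  ∃ (m : ℕ) (W : Fin m → Submodule K V) (u : Fin m → Fin n → V) (c : Fin m → ℚ)
    (G : SimpleGraph (Fin m)),
    0 < m ∧ G.Connected ∧
    (∀ i, 0 < c i) ∧
    (∀ i, Module.finrank K (W i) = n) ∧
    (∀ i j, u i j ∈ W i) ∧ (∀ i, LinearIndependent K (u i)) ∧
    (∀ i j, G.Adj i j → Module.finrank K (W i ⊓ W j : Submodule K V) = n - 1) ∧
    (∀ i j k, G.Adj i j → G.Adj j k → G.Adj i k →
      Module.finrank K (W i ⊔ W j ⊔ W k : Submodule K V) = n + 1) ∧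
    (∀ i j, i ≠ j → ¬ G.Adj i j →
      ∃ v : Fin m → V, (∀ a b, G.Adj a b → v a - v b ∈ W a ⊔ W b) ∧ v i - v j ∉ W i ⊔ W j) ∧
    (∀ φ : V →ₗ[ℚ] V,
      φ ∘ₗ ((α • ε).restrictScalars ℚ) = ((α • ε).restrictScalars ℚ) ∘ₗ φ →
      (∀ x y : V, E (φ x) y + E x (φ y) = 0) →
      LinearMap.trace ℚ V φ = 0 → LinearMap.trace ℚ V (((α • ε).restrictScalars ℚ) ∘ₗ φ) = 0 →
      derivationExteriorPower φ (n * 2)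
        (∑ i : Fin m, c i • exteriorPower.ιMulti ℚ (n * 2)
          (fun t : Fin (n * 2) => if t.modNat = 0 then u i t.divNat else α • u i t.divNat)) = 0) ∧
    derivationExteriorPower ((α • ε).restrictScalars ℚ) (n * 2)
        (∑ i : Fin m, c i • exteriorPower.ιMulti ℚ (n * 2)
          (fun t : Fin (n * 2) => if t.modNat = 0 then u i t.divNat else α • u i t.divNat)) ≠ 0

/-- `CMWeil[]` — Weil classes are algebraic for every CM-field action, on the tree's real carriers:
for `ψ ∈ End(A)` whose pull-back on `H¹(A(ℂ); ℂ)` is semisimple with non-real eigenvalues `μ ∈ S`,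
each of multiplicity exactly `2p`, every rational `(p,p)`-class in the span of the top-wedge
eigenclass lines `⋀^{2p} H¹_μ = pullbackEigenclasses A ψ (2p) ((x,y) ↦ (x + yμ)^{2p})` is algebraic
(van Geemen 4.8–4.9; Deligne–Milne LNM 900 (4.3)–(4.4)). For `ψ² = -d`, `S = {±i√d}`, `p = n` this is
the route `TropicalCuspLift`'s `WeilClassesAlgebraic`; for a CM field `K = ℚ(β)`, `ψ = η(β)`,
`S = {σ(β)}`, `2p = dim_K H¹` it is the algebraicity of `W_K = ⋀^{2p}_K H¹(A, ℚ)` (all types, split or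
not). Local notation only. -/
local notation3 (prettyPrint := false) "CMWeil[]" =>
  ∀ (A : AbelianVariety ℂ) (ψ : A ⟶ A) (p : ℕ) (S : Finset ℂ), 0 < p →
    (∀ μ ∈ S, μ.im ≠ 0) →
    (⨆ μ ∈ S, Module.End.eigenspace (HodgeTheory.complexBetti.map ψ.hom.hom.hom 1).hom μ) = ⊤ →
    (∀ μ ∈ S, Module.finrank ℂ
        (Module.End.eigenspace (HodgeTheory.complexBetti.map ψ.hom.hom.hom 1).hom μ) = 2 * p) →
    ∀ c : HodgeTheory.complexBetti A.X (2 * p), HodgeTheory.IsRationalClass c →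
      HodgeTheory.IsOfHodgeType A.dim A.X (2 * p) p p c →
      c ∈ (⨆ μ ∈ S, HodgeTheory.pullbackEigenclasses A ψ (2 * p)
              (fun x y => ((x : ℂ) + (y : ℂ) * μ) ^ (2 * p))) →
      c ∈ HodgeTheory.algebraicClasses A.X p

/-- `IsCM[A]` — `A` is of CM type: some endomorphism of `A` has `2 · dim A` distinct eigenvalues on
`H¹(A(ℂ); ℂ)` (equivalently `End⁰(A) ⊇` an étale commutative `ℚ`-subalgebra of rank `2 dim A`;
Mumford, *Abelian Varieties* §22; Markman survey §1.1). Local notation only. -/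
local notation3 (prettyPrint := false) "IsCM[" A "]" =>
  ∃ (ψ : A ⟶ A) (μ : Fin (2 * AbelianVariety.dim A) → ℂ), Function.Injective μ ∧
    ∀ i, Module.End.HasEigenvalue (HodgeTheory.complexBetti.map ψ.hom.hom.hom 1).hom (μ i)

/-- `HCCM[]` — the Hodge conjecture for complex abelian varieties of CM type. Local notation only. -/
local notation3 (prettyPrint := false) "HCCM[]" =>
  ∀ A : AbelianVariety ℂ, IsCM[A] → HodgeTheory.HodgeConjectureFor A.dim A.X

/-- `FibreIncl[f, B, e, s]` — `e : B.X ⟶ 𝒳` presents the abelian variety `B` as THE fibre of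
`f : 𝒳 ⟶ S` over the complex point `s` (an isomorphism with the fibre product `𝒳 ×_S Spec ℂ`, tree
`Motives.fiberOver`/`fiberι`, followed by the fibre inclusion). Local notation only. -/
local notation3 (prettyPrint := false) "FibreIncl[" f ", " B ", " e ", " s "]" =>
  ∃ i : AbelianVariety.X B ≅ fiberOver f s, e = i.hom ≫ fiberι f s

/-- `HodgeAlong[S, 𝒳, f, G, p]` — the global class `G ∈ H^{2p}(𝒳(ℂ); ℂ)` restricts to a RATIONAL
class of Hodge type `(p,p)` on every fibre of `f` presented as an abelian variety. Local notation only. -/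
local notation3 (prettyPrint := false) "HodgeAlong[" S ", " 𝒳 ", " f ", " G ", " p "]" =>
  ∀ (B : AbelianVariety ℂ) (eB : AbelianVariety.X B ⟶ 𝒳) (u : ComplexPoints S),
    FibreIncl[f, B, eB, u] →
      HodgeTheory.IsRationalClass (HodgeTheory.complexBetti.map eB (2 * p) G) ∧
      HodgeTheory.IsOfHodgeType B.dim B.X (2 * p) p p (HodgeTheory.complexBetti.map eB (2 * p) G)

/-- `CMFamilies[]` — CM-ANCHORED MUMFORD–TATE PACKAGING (stub 4): Hodge models exist for abelian
varieties, and every rational `(p,p)`-class `c` on `A` is the restriction of a global class `G` of a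
smooth projective family over a smooth irreducible quasi-projective complex base, Hodge and rational
on every abelian fibre, with a fibre of CM type. Local notation only. -/
local notation3 (prettyPrint := false) "CMFamilies[]" =>
  (∀ A : AbelianVariety ℂ, Nonempty (HodgeTheory.HodgeModel A.dim A.X)) ∧
  ∀ (A : AbelianVariety ℂ) (p : ℕ) (c : HodgeTheory.complexBetti A.X (2 * p)),
    HodgeTheory.IsRationalClass c → HodgeTheory.IsOfHodgeType A.dim A.X (2 * p) p p c →
    ∃ (S 𝒳 : SchemeOver ℂ) (f : 𝒳 ⟶ S) (G : HodgeTheory.complexBetti 𝒳 (2 * p))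
      (t s₀ : ComplexPoints S) (e : A.X ⟶ 𝒳) (A₀ : AbelianVariety ℂ) (e₀ : A₀.X ⟶ 𝒳),
      HodgeTheory.IsQuasiProjectiveOver S ∧ AlgebraicGeometry.Smooth S.hom ∧ IrreducibleSpace S.left ∧
      IsSmoothProjectiveFamily f A.dim ∧
      FibreIncl[f, A, e, t] ∧ FibreIncl[f, A₀, e₀, s₀] ∧ IsCM[A₀] ∧
      HodgeTheory.complexBetti.map e (2 * p) G = c ∧ HodgeAlong[S, 𝒳, f, G, p]

/-- `VHCfromCM[]` — the variational Hodge statement ANCHORED AT A CM FIBRE (stub 5): for a smooth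
projective family over a smooth irreducible quasi-projective complex base and a global class `G`
that is a rational `(p,p)`-class on every abelian fibre, algebraicity of `G` on one CM fibre implies
algebraicity on every abelian fibre. Local notation only. -/
local notation3 (prettyPrint := false) "VHCfromCM[]" =>
  ∀ (S 𝒳 : SchemeOver ℂ) (f : 𝒳 ⟶ S) (m p : ℕ) (G : HodgeTheory.complexBetti 𝒳 (2 * p))
    (s₀ : ComplexPoints S) (A₀ : AbelianVariety ℂ) (e₀ : A₀.X ⟶ 𝒳),
    HodgeTheory.IsQuasiProjectiveOver S → AlgebraicGeometry.Smooth S.hom → IrreducibleSpace S.left →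
    IsSmoothProjectiveFamily f m →
    FibreIncl[f, A₀, e₀, s₀] → IsCM[A₀] →
    HodgeTheory.complexBetti.map e₀ (2 * p) G ∈ HodgeTheory.algebraicClasses A₀.X p →
    HodgeAlong[S, 𝒳, f, G, p] →
    ∀ (B : AbelianVariety ℂ) (eB : B.X ⟶ 𝒳) (u : ComplexPoints S), FibreIncl[f, B, eB, u] →
      HodgeTheory.complexBetti.map eB (2 * p) G ∈ HodgeTheory.algebraicClasses B.X p

/-! ### The five registered stubs -/

/-- **Stub 1 — `GalleryDesigns[]`: the card's finite design problem for every `n ≥ 2` (pure linear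
algebra over the abstract split CM anchor datum; decidable per `n`; the line's cheapest falsifier).**
DATUM: `K = ℚ(α)`, `α² = -d < 0`; `V` a `K`-space of dimension `2n` (`H₁(A₀, ℚ)` of `A₀ = E_K^{2n}`
with `K` acting DIAGONALLY = the complex structure `J = σ(α)/√d`, so that complex subtori of
dimension `n` are exactly the `n`-dimensional `K`-subspaces); `ε` a `K`-linear involution with
`±1`-eigenspaces of dimension `n` (the splitting `B₊ × B₋`; the Weil action of the card is
`α_W = α·ε = (σ, σ̄)`); `E` alternating, `E(αx, αy) = d·E(x,y)`, `E(εx, εy) = E(x,y)`, Riemann-positive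
`E(x, αx) > 0` (product polarisation), hyperbolic for `α_W` (an `α_W`-stable `E`-Lagrangian rational
subspace of dimension `2n`: van Geemen LNM 1594 Lemma 5.2 (2)–(3), 5.4). CLAIM: there is a GALLERY
DESIGN — `n`-dimensional `K`-subspaces `Wᵢ` with `K`-bases `uᵢ`, weights `cᵢ ∈ ℚ_{>0}`, an adjacency
graph `G`: connected (triage I3), adjacent pairs meeting in dimension `n - 1` (normal crossings inside
the `(n+1)`-dimensional `Wᵢ + Wⱼ`), coplanar triangles (`dim (Wᵢ + Wⱼ + Wₖ) = n + 1`: lci at triple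
points, TRIAGE r1-3), non-adjacent pairs translatable apart compatibly with the incidences (for each
such pair a solution `v` of the edge system `vₐ - v_b ∈ Wₐ + W_b` with `vᵢ - vⱼ ∉ Wᵢ + Wⱼ`; a generic
point of the identity component of the incidence torus then realises a reduced lci gallery
`Z₀ = ⋃ (Bᵢ + xᵢ)`) — whose weighted class `x = Σ cᵢ · (uᵢ₁ ∧ αuᵢ₁ ∧ ⋯ ∧ uᵢₙ ∧ αuᵢₙ) ∈ ⋀^{2n}_ℚ V`
(complex orientation; `= Σ cᵢ [Bᵢ] ∈ H_{2n}(A₀, ℚ)`) is annihilated by the derivations of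
`𝔰𝔲(H_W) = {φ : φ α_W = α_W φ, E(φx,y) + E(x,φy) = 0, tr_{K_W} φ = 0}` (typed: `ℚ`-linear `φ`
commuting with `α•ε`, `E`-skew, `tr_ℚ φ = tr_ℚ(α_W φ) = 0`) — i.e. `x ∈ ℚ·PD(θⁿ) ⊕ PD(W_K)`, the
generic Hodge classes of the Weil family through the anchor, so that Bloch's theorem deforms the seed
over the whole component — and NOT by `D_{α_W}` (non-zero Weil component: `D_{α_W}` has eigenvalue
`(a - b)σ(α)` on `⋀ᵃV_σ ⊗ ⋀ᵇV_σ̄`, zero exactly on the `(n,n)`-part containing `PD(θⁿ)`).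
Representation-theoretic normal form of the card §(4): Schur averaging over a finite `D ⊂ SU(h)(K)`
of graph subtori + Grassmannian product fillers; adjacency = reflections (complex reflections `r, r²`
with a common root line give coplanar triangles; transposition graphs are triangle-free); necessary
conditions: the annihilator lemma (`⋂ᵢ Wᵢ = 0`, ≥ 3 members, no pencil) and EKR at `n = 2`
(TRIAGE r1-3). Calibration `n = 3` (split sixfolds are algebraic: a design SHOULD exist), prize
`n = 4`. Bloch-semiregularity of the realised gallery is NOT part of this statement (no genuine
carrier for Bloch's map in the tree): it is verified inside stub 2. [informal size M–L per `n`;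
`kit`-decidable] -/
theorem stub_galleryDesigns : GalleryDesigns[] := by
  sorry

/-- **Stub 2 — the ENGINE (hardest): gallery designs ⟹ Weil classes are algebraic for every
CM-field action, `GalleryDesigns[] → CMWeil[]`.** (e = 2, the card) realise a design at the split CM
anchor `E_K^{2n}` as a reduced lci gallery `Z₀` with `[Z₀] = aθⁿ + w`, `w ≠ 0`; VERIFY
Bloch-semiregularity of `Z₀` (`H¹(Z₀, N_{Z₀/A₀}) → H^{n+1}(A₀, Ω^{n-1})` injective — the card's job
GALLERY-n (β), Mayer–Vietoris along the double locus, TRIAGE r1-1's per-component necessary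
condition `ob_{Bᵢ}(κ) ∈ span_j{c̄(D_ij) ⊗ ν_ij}`; budget `dim H^{n+1}(Ω^{n-1}) = C(2n,n-1)²`); Bloch
1972 (Invent. Math. 17, semiregularity ⟹ the Hilbert scheme is smooth over the locus where the class
stays in `Fⁿ`) / Buchweitz–Flenner 2003 Prop. 8.2 ⟹ `Z₀` deforms over a Euclidean neighbourhood of
the anchor in the hyperbolic PEL component, where exactly `ℚθⁿ ⊕ W_K` stay Hodge ⟹ Baire +
irreducibility + specialisation ⟹ every hyperbolic member ⟹ `K`-isogeny descent (tree
`WeilClassesIsogenyDescent`) ⟹ descending `2n+2 → 2n` to every discriminant (Schoen 1998 §10, Koike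
2004, Markman survey arXiv:2509.23403 §11.5 Step 2; tree `WeilClassesProducts`; crux stmt-1260's
line `hyperbolic-eightfold-descent` types the `d = 7` instance). (general CM field `K`, which André
needs) the split `K`-Weil components contain points isogenous to powers of CM elliptic curves
`E_{K'}` (`K ↪ M_g(K')`, signature automatic), where the Weil classes are Lefschetz and galleries of
codimension-`p` subtori exist: same lever, design problem NOT typed here (beyond the card); non-split
types by descending (`H ⊕ (-H)` hyperbolic). Known cases: `p`-part `n = 2` all `K` (Markman 2025, tree
fact `Markman2025_weilClasses_algebraic_abelianFourfold`), split sixfolds (arXiv:2502.03415); first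
new output: split `ℚ(√-d)`-eightfolds ⟹ ALL Weil sixfolds (`Disproof.weilItems_of` frontier,
arXiv:2603.20268 §1). The guard hypotheses of `CMWeil[]` exclude `ψ = 𝟙` (HC itself) and real
multiplication. [informal size XL; open beyond `2n ≤ 6`] -/
theorem stub_galleryEngine : GalleryDesigns[] → CMWeil[] := by
  sorry

/-- **Stub 3 — André's reduction, `CMWeil[] → HCCM[]` (known; André 1992 = Markman survey
arXiv:2509.23403 Thm. 1.4, READ p. 4).** For `A` of CM type there are abelian varieties `Aᵢ` of split
Weil type (for CM fields `Kᵢ`) and homomorphisms `fᵢ : A → Aᵢ` with every Hodge class on `A` of the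
form `Σ fᵢ^*(tᵢ)`, `tᵢ` Weil classes; pull-backs of algebraic classes are algebraic (tree
`PulledBackAlgebraicClasses`); the Weil classes `tᵢ` are instances of `CMWeil[]` (`ψ = ηᵢ(β)` for a
totally non-real primitive `β ∈ Kᵢ`, `S = {σ(β)}`, eigenspaces of dimension `dim_{Kᵢ} H¹ = 2p`); the
anti-vacuity conjunct `Nonempty (HodgeModel _ _)` is GAGA + Hodge decomposition for the projective
manifold `A(ℂ)` (tree named fact `nonempty_hodgeModel`, to be proved or threaded). `IsCM[A]`
(an endomorphism with `2 dim A` distinct eigenvalues on `H¹`) ⟺ `ℚ[ψ] ⊆ End⁰(A)` is an étale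
commutative subalgebra of rank `2g` ⟺ CM type (every étale `ℚ`-algebra is monogenic).
[informal size XL (formalising André's MT-torus argument); research risk nil] -/
theorem stub_andreCM : CMWeil[] → HCCM[] := by
  sorry

/-- **Stub 4 — `CMFamilies[]`, CM-anchored Mumford–Tate packaging (theorem in print).** (a) Every
complex abelian variety has a Hodge model (Serre GAGA + Hodge decomposition; tree named fact
`nonempty_hodgeModel` with `AbelianVariety.isSmoothProjective_holds`). (b) Given `(A, c)`, `c`
rational of type `(p,p)`: take the universal family over the moduli scheme of polarised abelian
varieties with level-`N` structure (`N ≥ 3`, fine, smooth quasi-projective over `ℂ`), the irreducible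
component through `(A, c)` of the Hodge locus of `c` — algebraic by Cattani–Deligne–Kaplan 1995
Cor. 1.2 (barrier file `Literature.Barriers.HodgeConjecture.HodgeLocusAlgebraic`, used positively) and
a special (Shimura) subvariety because Hodge classes on abelian varieties are absolute Hodge
(Deligne 1982; barrier `hodgeClassesAreAbsoluteFor_abelianVariety`, proof-side) — pass to a finite
cover `S` on which the flat transport of `c` is single-valued, restrict the universal family:
`f : 𝒳 → S` is smooth projective of relative dimension `dim A` over an irreducible quasi-projective
base; the flat section is the restriction of a GLOBAL class `G ∈ H^{2p}(𝒳(ℂ); ℂ)` (theorem of the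
fixed part, Deligne Hodge II 4.1.1; tree `GlobalInvariantCycles`), rational and `(p,p)` on every fibre
by construction; special subvarieties contain CM points (Deligne, Travaux de Shimura 5.1; Mumford
1969), giving the CM fibre `A₀`; fibres are presented by isomorphisms with the fibre products
(`FibreIncl`). [informal size L–XL (moduli infrastructure on the tree's carriers); known] -/
theorem stub_cmAnchoredFamilies : CMFamilies[] := by
  sorry

/-- **Stub 5 — `VHCfromCM[]`, the variational Hodge statement anchored at a CM fibre (open; the
general-sector remainder of the crux and the second home of the lever).** For a smooth projective
family over an irreducible quasi-projective complex base and a global class `G` which is a rational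
`(p,p)`-class on every abelian fibre: `G` algebraic on ONE CM fibre ⟹ `G` algebraic on every abelian
fibre. Grothendieck's variational Hodge conjecture restricted to abelian fibres and CM base points;
implied by HC; with stubs 3–4 equivalent to the non-CM part of the crux (Bloch–Esnault–Kerz 2014
char. 0, appendix: VHC for abelian schemes ⟹ HC for abelian varieties). The line's road: at the CM
fibre (chosen by stub 4's freedom as an `E_{K'}`-power point whenever the special subvariety has one)
represent `G|_{A₀}` + divisor padding by a Bloch-semiregular gallery, Bloch 1972 ⟹ algebraic on a
Euclidean neighbourhood of `s₀`, Baire + irreducibility ⟹ a Zariski-dense set, specialisation (the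
route's typed support `HodgeLocusPropagation` pattern) ⟹ every fibre. Its first instances are the
hyperbolic Weil families of stub 2. [informal size XL; open, HC-hard] -/
theorem stub_vhcFromCMFibre : VHCfromCM[] := by
  sorry

/-! ### The composition (sorry-free) and the crux BY NAME -/

/-- **The five stub statements imply the Hodge conjecture for every complex abelian variety**
(sorry-free glue). Given `A`, a Hodge model exists by stub 4 (a); given a rational `(p,p)`-class `c`,
stub 4 (b) packages `(A, c)` into a CM-anchored family with global class `G`; stubs 1–3 give HC on the
CM fibre `A₀`, so `G|_{A₀}` is algebraic; stub 5 transports algebraicity to the fibre `A`, where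
`G|_A = c`. [folklore assembly] -/
theorem lineImplication (h₁ : GalleryDesigns[]) (h₂ : GalleryDesigns[] → CMWeil[])
    (h₃ : CMWeil[] → HCCM[]) (h₄ : CMFamilies[]) (h₅ : VHCfromCM[]) :
    ∀ A : AbelianVariety ℂ, HodgeTheory.HodgeConjectureFor A.dim A.X := by
  have hcm : HCCM[] := h₃ (h₂ h₁)
  obtain ⟨hM, hfam⟩ := h₄
  intro A
  refine ⟨hM A, fun p c hc hh => ?_⟩
  obtain ⟨S, 𝒳, f, G, t, s₀, e, A₀, e₀, hqp, hsm, hirr, hfamily, hAt, hA₀, hCM, hGc, hHodge⟩ :=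
    hfam A p c hc hh
  have h₀ := hHodge A₀ e₀ s₀ hA₀
  have halg₀ : HodgeTheory.complexBetti.map e₀ (2 * p) G ∈ HodgeTheory.algebraicClasses A₀.X p :=
    (hcm A₀ hCM).2 p _ h₀.1 h₀.2
  have hA := h₅ S 𝒳 f A.dim p G s₀ A₀ e₀ hqp hsm hirr hfamily hA₀ hCM halg₀ hHodge A e t hAt
  rw [hGc] at hA
  exact hA

/-- **`HodgeAbelianVarieties_of` — the crux BY NAME from the five registered stubs** (the only
`sorry`s of the file live inside `stub_*`; `lineImplication` is sorry-free; this theorem takes no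
hypotheses). -/
theorem HodgeAbelianVarieties_of :
    Summit.HodgeConjecture.HodgeConjecture.Theses.PadicSemiregularLift.HodgeAbelianVarieties :=
  lineImplication stub_galleryDesigns stub_galleryEngine stub_andreCM stub_cmAnchoredFamilies
    stub_vhcFromCMFibre

end Summit.HodgeConjecture.HodgeConjecture.Cruxes.HodgeAbelianVarieties.SubtorusGalleryBlochSeeds

end
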